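import Literature.Probability.Percolation.QuadCrossingExplorationExitSetStrip
import Literature.Probability.Percolation.QuadCrossingExplorationWalls
import Literature.Probability.Percolation.QuadCrossingSeparatorArmMid
import Literature.Probability.Percolation.QuadCrossingContinuityCaseTwoTame
import HarnessLib

/-!
# Decoupling over the lowest AND the uppermost crossing (Lemma 6.1, case (2), no cut point)

Topic `Probability/Percolation`; proofs file towards the named fact `SchrammSmirnov2011_lemma_6_1`
(`QuadCrossingContinuity.lean`; O. Schramm, S. Smirnov, *On the scaling limits of planar
percolation*, Ann. Probab. 39 (2011), arXiv:1101.5820, proof of Lemma 6.1, case (2), eq. (6.2):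
"The lowest crossing `γ` depends only on the configuration inside `M`, so the restriction of `ω`
to `[Q] ∖ M` is unbiased", applied in the printed proof to the lowest crossing when its landing
point is far from `∂₃Q` and, "the other case being symmetric", to the uppermost one).

`QuadCrossingContinuityCaseTwoTame.lean` decouples over ONE exploration and therefore needs the
two landing points to be sorted by Schramm–Smirnov's cut point.  Here both explorations are used at
once: `Frame.Charts.measureReal_crossed_not_crossed_mid_le` bounds the probability of
`⊞_{Q'} ∧ ¬⊞_Q ∧ (x close to ∂₃Q) ∧ (x' close to ∂₁Q)` — `x`, `x'` the landing points of the lowest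
and the uppermost crossing of `Q'` — by `η · P(⊞_{Q'})`, where `η` bounds the probability of a
closed dual crossing of either of the two annulus shapes of the middle arm
(`QuadCrossingSeparatorArmMid.lean`).  The datum is the PAIR `(Λ, Λ_T)` of explored regions
(finitely many values); `{Λ = Λ₀} ∩ {Λ_T = Λ₁}` is determined by the union of the two revealed edge
sets; on the event the middle arm exists off that union (the lower exit set stays below the upper
wall by `QuadCrossingExplorationWalls.lean`; both explorations are leak-free under lattice tameness of
the big quad); independence of events on disjoint edge sets and "conditioning without
conditioning" finish as in the one-sided case.  Hypotheses: condition (2), lattice tameness of `Q`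
(`htame`), the chord–arc free side (`harc`) and local star-shapedness of `[Q']` at free-side points
(`hstar`, giving access to the landing points and hence no inversion); NO cut point.
Everything is proved; no named fact is introduced.

## References

* O. Schramm, S. Smirnov, Ann. Probab. 39 (2011) 1768–1814, arXiv:1101.5820, proof of Lemma 6.1,
  case (2), eq. (6.2). [SchrammSmirnov2011]
* G. Grimmett, *Percolation*, 2nd ed. (1999), §2.2, §11.8. [GrimmettPercolation1999]
-/

noncomputable section

open Set Metric Filter Function
open _root_.MeasureTheory _root_.Topology
open scoped ENNReal unitInterval
open Literature.Probability.LatticeModels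
open Literature.Topology.PlaneTopology

namespace Literature.Probability.Percolation

namespace SSContinuity

namespace Frame

variable (Φ : Frame) {D : Set ℂ} {Q Q' : QuadCrossing.Quad D}

/-- **Two short junctions from two points far apart do not meet**: if `x` is joined to `∂₃Q` and
`x'` to `∂₁Q` by paths of `[Q]` of diameter `< c₃`, and `2c₃ + 4R₁ < d₁(Q)`, then no point is
joined to both `x` and `x'` by paths of `[Q]` staying within `R₁` of them (the chain would join
`∂₃Q` to `∂₁Q` with diameter `< d₁(Q)`). [cite: SchrammSmirnov2011, proof of Lemma 6.1, case (2)] -/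
theorem far_apart_of_near_sides {x x' : ℂ} {c₃ R₁ : ℝ} (hR₁ : 0 ≤ R₁)
    (hnear₃ : ∃ t ∈ Q.side 3, ∃ p : Path x t, range p ⊆ Q.carrier ∧ Metric.diam (range p) < c₃)
    (hnear₁ : ∃ t ∈ Q.side 1, ∃ p : Path x' t, range p ⊆ Q.carrier ∧ Metric.diam (range p) < c₃)
    (hd : 2 * c₃ + 4 * R₁ < Q.sideDist 1) :
    ∀ z : ℂ, (∃ p : Path x z, range p ⊆ Q.carrier ∧ ∀ s, dist (p s) x ≤ R₁) →
      (∃ p : Path x' z, range p ⊆ Q.carrier ∧ ∀ s, dist (p s) x' ≤ R₁) → False := by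
  intro z ⟨j, hjQ, hj⟩ ⟨j', hj'Q, hj'⟩
  obtain ⟨t₃, ht₃, p₃, hp₃Q, hp₃d⟩ := hnear₃
  obtain ⟨t₁, ht₁, p₁, hp₁Q, hp₁d⟩ := hnear₁
  have hdj : Metric.diam (range j) ≤ 2 * R₁ := by
    refine Metric.diam_le_of_forall_dist_le (by positivity) ?_
    rintro _ ⟨a, rfl⟩ _ ⟨b, rfl⟩
    linarith [dist_triangle (j a) x (j b), dist_comm x (j b), hj a, hj b]
  have hdj' : Metric.diam (range j') ≤ 2 * R₁ := by
    refine Metric.diam_le_of_forall_dist_le (by positivity) ?_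
    rintro _ ⟨a, rfl⟩ _ ⟨b, rfl⟩
    linarith [dist_triangle (j' a) x' (j' b), dist_comm x' (j' b), hj' a, hj' b]
  -- the chain `t₁ → x' → z → x → t₃`
  let big : Path t₁ t₃ := p₁.symm.trans (j'.trans (j.symm.trans p₃))
  have hbig_range : range big = range p₁ ∪ (range j' ∪ (range j ∪ range p₃)) := by
    simp only [big, Path.trans_range, Path.symm_range]
  have hbigQ : range big ⊆ Q.carrier := by
    rw [hbig_range]
    exact union_subset hp₁Q (union_subset hj'Q (union_subset hjQ hp₃Q))
  have hd₁ : Q.sideDist 1 ≤ Metric.diam (range big) :=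
    QuadCrossing.Quad.sideDist_le (j := 1) ht₁ ht₃ big hbigQ
  have hx3 : x ∈ range j ∩ range p₃ := ⟨⟨0, j.source⟩, ⟨0, p₃.source⟩⟩
  have h3 : Metric.diam (range j ∪ range p₃) ≤ 2 * R₁ + c₃ := by
    have := Metric.diam_union' ⟨x, hx3⟩; linarith
  have hz2 : z ∈ range j' ∩ (range j ∪ range p₃) := ⟨⟨1, j'.target⟩, Or.inl ⟨1, j.target⟩⟩
  have h2 : Metric.diam (range j' ∪ (range j ∪ range p₃)) ≤ 2 * R₁ + (2 * R₁ + c₃) := by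
    have := Metric.diam_union' ⟨z, hz2⟩; linarith
  have hx'1 : x' ∈ range p₁ ∩ (range j' ∪ (range j ∪ range p₃)) :=
    ⟨⟨0, p₁.source⟩, Or.inl ⟨0, j'.source⟩⟩
  have h1 : Metric.diam (range big) ≤ c₃ + (2 * R₁ + (2 * R₁ + c₃)) := by
    rw [hbig_range]
    have := Metric.diam_union' ⟨x', hx'1⟩; linarith
  linarith

variable {Φ} in
/-- **Decoupling over the lowest and the uppermost crossing** (see the module docstring).
[cite: SchrammSmirnov2011, proof of Lemma 6.1, case (2), eq. (6.2)] -/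
theorem Charts.measureReal_crossed_not_crossed_mid_le (hΦ : Φ.Charts Q') (hb : Φ.b = 1)
    (hc : Φ.c = -1) (hd : Φ.d = 1) (hG : ∀ t : unitInterval, Φ.G ⟨1, 2 * (t : ℝ) - 1⟩ = Q' (1, t))
    (hcar : Q'.carrier ⊆ Q.carrier) (h0 : Q'.side 0 = Q.side 0) (h1 : Q'.side 1 ⊆ Q.side 1)
    (h3 : Q'.side 3 ⊆ Q.side 3)
    {ρ : ℝ} (hρ : 0 < ρ) (hρ0 : ρ < Q.sideDist 0)
    (hjoin : ∀ x ∈ Q'.side 2, Q.ShortJoin ρ x (Q.side 2))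
    (htame : ∀ a b : Site 2, (zdGraph 2).Adj a b →
      IsPreconnected (segment ℝ (meshPoint Φ.δ a) (meshPoint Φ.δ b) ∩ Q.carrier))
    {K : ℝ} (hK : 1 ≤ K)
    (harc : ∀ s t : unitInterval, dist (Q' (1, s)) (Q' (1, t)) ≤ ρ → ∀ u : unitInterval,
      ((s : ℝ) ≤ u ∧ (u : ℝ) ≤ t ∨ (t : ℝ) ≤ u ∧ (u : ℝ) ≤ s) → dist (Q' (1, u)) (Q' (1, s)) ≤ K * ρ)
    (hstar : ∀ x ∈ Q'.side 2, ∃ r > 0, ∀ u ∈ Q'.carrier, u ∈ ball x r → segment ℝ x u ⊆ Q'.carrier)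
    {c₃ r₀ ρm R₀ : ℝ} (hr₀ : K * ρ + 3 * Φ.δ ≤ r₀) (hslack₁ : r₀ + 2 * Φ.δ ≤ ρm)
    (hslack₂ : 3 * ρm + 2 * Φ.δ ≤ R₀) (hR₀ : 2 * R₀ + 2 * c₃ + 4 * (K * ρ) ≤ Q.sideDist 1)
    {η : ℝ} (hη0 : 0 ≤ η)
    (hη : ∀ x : ℂ, (bondPercolation (zdGraph 2) half).real
        (annulusDualCrossing x Φ.δ (r₀ + 2 * Φ.δ) (ρm - 2 * Φ.δ)) ≤ η ∧
      (bondPercolation (zdGraph 2) half).real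
        (annulusDualCrossing x Φ.δ (3 * ρm + 2 * Φ.δ) (R₀ - 2 * Φ.δ)) ≤ η) :
    (bondPercolation (zdGraph 2) half).real
      {ω | (∃ K', Q'.IsCrossing K' ∧ K' ⊆ openEdgeUnion Φ.δ ω) ∧
        (¬ ∃ K, Q.IsCrossing K ∧ K ⊆ openEdgeUnion Φ.δ ω) ∧
        (∃ t ∈ Q.side 3, ∃ p : Path (Φ.G (Φ.wallPt ω)) t,
          range p ⊆ Q.carrier ∧ Metric.diam (range p) < c₃) ∧
        ∃ t ∈ Q.side 1, ∃ p : Path (Φ.flipFrame.G (Φ.flipFrame.wallPt ω)) t,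
          range p ⊆ Q.carrier ∧ Metric.diam (range p) < c₃} ≤
      η * (bondPercolation (zdGraph 2) half).real
        {ω | ∃ K', Q'.IsCrossing K' ∧ K' ⊆ openEdgeUnion Φ.δ ω} := by
  set ΦT := Φ.flipFrame with hΦTdef
  have hΦT : ΦT.Charts Q'.flip := SSContinuity.Frame.Charts.flipFrame Φ hΦ
  have hGT : ∀ t : unitInterval, ΦT.G ⟨1, 2 * (t : ℝ) - 1⟩ = Q'.flip (1, t) := Φ.flipFrame_chart hG
  have hTb : ΦT.b = 1 := by simp [hΦTdef, hb]
  have hTc : ΦT.c = -1 := by simp [hΦTdef, hd]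
  have hTd : ΦT.d = 1 := by simp [hΦTdef, hc]
  have hδ := Φ.hδ
  have hδT : ΦT.δ = Φ.δ := by simp [hΦTdef]
  have hKρ0 : 0 ≤ K * ρ := by positivity
  -- the flipped pair
  have hcarT : Q'.flip.carrier ⊆ Q.flip.carrier := by simpa using hcar
  have h0T : Q'.flip.side 0 = Q.flip.side 0 := by simpa using h0
  have h1T : Q'.flip.side 1 ⊆ Q.flip.side 1 := by simpa using h3
  have h3T : Q'.flip.side 3 ⊆ Q.flip.side 3 := by simpa using h1
  have hjoinT : ∀ x ∈ Q'.flip.side 2, Q.flip.ShortJoin ρ x (Q.flip.side 2) := fun x hx => by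
    rw [QuadCrossing.Quad.flip_side_two] at hx ⊢
    rw [QuadCrossing.Quad.flip_shortJoin_iff]
    exact hjoin x hx
  have hρ0T : ρ < Q.flip.sideDist 0 := by rwa [QuadCrossing.Quad.flip_sideDist_zero]
  have htameT : ∀ a b : Site 2, (zdGraph 2).Adj a b →
      IsPreconnected (segment ℝ (meshPoint ΦT.δ a) (meshPoint ΦT.δ b) ∩ Q.flip.carrier) := by
    rw [QuadCrossing.Quad.flip_carrier, hδT]; exact htame
  have harcT := QuadCrossing.Quad.flip_arc harc
  -- the events and the data
  set μ := bondPercolation (zdGraph 2) half with hμ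
  set Ev : Set (BondConfig (Site 2)) := {ω | (∃ K', Q'.IsCrossing K' ∧ K' ⊆ openEdgeUnion Φ.δ ω) ∧
      (¬ ∃ K, Q.IsCrossing K ∧ K ⊆ openEdgeUnion Φ.δ ω) ∧
      (∃ t ∈ Q.side 3, ∃ p : Path (Φ.G (Φ.wallPt ω)) t,
        range p ⊆ Q.carrier ∧ Metric.diam (range p) < c₃) ∧
      ∃ t ∈ Q.side 1, ∃ p : Path (ΦT.G (ΦT.wallPt ω)) t,
        range p ⊆ Q.carrier ∧ Metric.diam (range p) < c₃} with hEv
  set B : Set (BondConfig (Site 2)) := {ω | ∃ K', Q'.IsCrossing K' ∧ K' ⊆ openEdgeUnion Φ.δ ω} with hB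
  set 𝒟 : Set (Set ℂ × Set ℂ) := {d | ∃ ω, Φ.explored ω = d.1 ∧ ΦT.explored ω = d.2 ∧ Φ.Crossed Φ.b ω}
    with h𝒟
  have h𝒟c : 𝒟.Countable := by
    refine ((Φ.finite_range_explored.prod ΦT.finite_range_explored).subset ?_).countable
    rintro d ⟨ω, hω1, hω2, -⟩
    exact ⟨⟨ω, hω1⟩, ⟨ω, hω2⟩⟩
  set A : Set ℂ × Set ℂ → Set (BondConfig (Site 2)) := fun d =>
    {ω | Φ.explored ω = d.1} ∩ {ω | ΦT.explored ω = d.2} with hA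
  set Sd : Set ℂ × Set ℂ → Set (Sym2 (Site 2)) := fun d => Φ.revealedIn d.1 ∪ ΦT.revealedIn d.2
    with hSd
  set F : Set ℂ × Set ℂ → Set (BondConfig (Site 2)) := fun d =>
    annulusDualCrossingOff (Sd d) (Φ.armCentre d.1) Φ.δ
      (QuadCrossing.Quad.midInner (dist (ΦT.armCentre d.2) (Φ.armCentre d.1)) r₀ ρm + 2 * Φ.δ)
      (QuadCrossing.Quad.midOuter (dist (ΦT.armCentre d.2) (Φ.armCentre d.1)) ρm R₀ - 2 * Φ.δ)
    with hF
  -- the key inclusion: on the event, the middle closed arm off the union of the revealed edges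
  have hkey : ∀ ω ∈ Ev, ω ∈ F (Φ.explored ω, ΦT.explored ω) := by
    rintro ω ⟨⟨K', hK', hK'O⟩, hnot, hnear₃, hnear₁⟩
    have hcr : Φ.Crossed Φ.b ω := hΦ.crossed hK' hK'O
    have hcrT : ΦT.Crossed ΦT.b ω := Crossed.flipFrame Φ hcr
    -- lower data
    obtain ⟨Γ, hΓ⟩ := Φ.exists_frontierCrossing hcr
    obtain ⟨hLO, hLQ', hLc, hLconn, hL0', -⟩ := hΦ.image_isFrontierCrossing hΓ
    have hxL : Φ.G (Φ.wallPt ω) ∈ Φ.G '' Γ := Φ.image_wallPt_mem hcr hΓ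
    have hx2 : Φ.G (Φ.wallPt ω) ∈ Q'.side 2 := hΦ.image_wallPt_mem_side_two hcr
    obtain ⟨y₂, hy₂, α, hαQ, hαdiam⟩ := hjoin _ hx2
    have hαx : ∀ s, dist (α s) (Φ.G (Φ.wallPt ω)) ≤ ρ := fun s =>
      (dist_le_diam_of_mem (isCompact_range α.continuous).isBounded ⟨s, rfl⟩ ⟨0, α.source⟩).trans hαdiam
    have hα0 : ∀ s, α s ∉ Q'.side 0 := fun s hs => by
      rw [h0] at hs
      have := QuadCrossing.Quad.sideDist_le hs hy₂ (QuadCrossing.Quad.tailPath α s)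
        ((QuadCrossing.Quad.range_tailPath α s).trans hαQ)
      have hle : Metric.diam (range (QuadCrossing.Quad.tailPath α s)) ≤ ρ :=
        (diam_mono (QuadCrossing.Quad.range_tailPath α s) (isCompact_range α.continuous).isBounded).trans
          hαdiam
      linarith
    obtain ⟨E, m, M, hEc, hEpc, hEQ, hxE, hE2, hEjoin, hAE, hEm, hE0, hE6, hTM, ⟨hMrect, hMdist⟩,
      -, hEM, hEanch⟩ :=
      hΦ.exists_exitSet_strip hb hc hd hG hcr hρ.le hK harc hcar h0 h1 h3 hy₂ α hαQ hαx hα0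
    -- upper data
    obtain ⟨Γ', hΓ'⟩ := ΦT.exists_frontierCrossing hcrT
    obtain ⟨hL'O, hL'Q', hL'c, hL'conn, hL'0', -⟩ := hΦT.image_isFrontierCrossing hΓ'
    have hx'L' : ΦT.G (ΦT.wallPt ω) ∈ ΦT.G '' Γ' := ΦT.image_wallPt_mem hcrT hΓ'
    have hx'2 : ΦT.G (ΦT.wallPt ω) ∈ Q'.flip.side 2 := hΦT.image_wallPt_mem_side_two hcrT
    obtain ⟨y₂', hy₂', α', hα'Q, hα'diam⟩ := hjoinT _ hx'2
    have hα'x : ∀ s, dist (α' s) (ΦT.G (ΦT.wallPt ω)) ≤ ρ := fun s =>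
      (dist_le_diam_of_mem (isCompact_range α'.continuous).isBounded ⟨s, rfl⟩ ⟨0, α'.source⟩).trans
        hα'diam
    have hα'0 : ∀ s, α' s ∉ Q'.flip.side 0 := fun s hs => by
      rw [h0T] at hs
      have := QuadCrossing.Quad.sideDist_le hs hy₂' (QuadCrossing.Quad.tailPath α' s)
        ((QuadCrossing.Quad.range_tailPath α' s).trans hα'Q)
      have hle : Metric.diam (range (QuadCrossing.Quad.tailPath α' s)) ≤ ρ :=
        (diam_mono (QuadCrossing.Quad.range_tailPath α' s)
          (isCompact_range α'.continuous).isBounded).trans hα'diam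
      linarith
    obtain ⟨E', m', M', hE'c, hE'pc, hE'QT, hx'E', hE'2T, hE'joinT, hAE', hE'm, hE'0, -, hTM',
      ⟨hM'rect, hM'dist⟩, -, hE'M, -⟩ :=
      hΦT.exists_exitSet_strip hTb hTc hTd hGT hcrT hρ.le hK harcT hcarT h0T h1T h3T hy₂' α' hα'Q
        hα'x hα'0
    have hE'Q : E' ⊆ Q.carrier := by simpa using hE'QT
    have hE'2 : (E' ∩ Q.side 2).Nonempty := by simpa using hE'2T
    have hE'join : ∀ e ∈ E', ∃ p : Path (ΦT.G (ΦT.wallPt ω)) e, range p ⊆ Q.carrier ∧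
        ∀ s, dist (p s) (ΦT.G (ΦT.wallPt ω)) ≤ K * ρ := fun e he => by
      obtain ⟨p, hpQ, hp⟩ := hE'joinT e he
      exact ⟨p, by simpa using hpQ, hp⟩
    have hL'Q : ΦT.G '' Γ' ⊆ Q.carrier := fun z hz => by
      have : z ∈ Q'.flip.carrier := hL'Q' hz
      rw [QuadCrossing.Quad.flip_carrier] at this
      exact hcar this
    have hL'0 : (ΦT.G '' Γ' ∩ Q.side 0).Nonempty := by
      have := hL'0'
      rwa [QuadCrossing.Quad.flip_side_zero, h0] at this
    have hL'OΦ : ΦT.G '' Γ' ⊆ openEdgeUnion Φ.δ ω := by rw [← hδT]; exact hL'O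
    -- access and no inversion
    have hx2T : ΦT.G (ΦT.wallPt ω) ∈ Q'.side 2 := by
      rwa [QuadCrossing.Quad.flip_side_two] at hx'2
    have acc₁ := hΦ.exists_access hcr (hstar _ hx2)
    have acc₃ := hΦT.exists_access hcrT (by
      obtain ⟨r, hr, h⟩ := hstar _ hx2T
      exact ⟨r, hr, fun u hu hub => by
        rw [QuadCrossing.Quad.flip_carrier] at hu ⊢; exact h u hu hub⟩)
    have hsum := Φ.wallTop_add_wallTop_le hcr acc₁ acc₃
    -- the two landing points are far apart
    have hd₁ : 2 * c₃ + 4 * (K * ρ) < Q.sideDist 1 := by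
      have : 0 < R₀ := by linarith [hδ]
      linarith
    have hxx' := far_apart_of_near_sides (Q := Q) hKρ0 hnear₃ hnear₁ hd₁
    -- the lower exit set stays below the upper wall
    have hEM' := hΦ.exitSet_not_mem_above hb hc hd hG hcar h1 hcr hcrT hΓ' hρ.le hK harc α hEQ
      hEjoin hE6 hEM hTM hMrect hMdist hEanch hE'join hE'M hTM' hM'rect hM'dist hsum hxx'
    -- the no-leak property of both explorations
    have hWpc : IsPreconnected (Φ.G '' Γ ∪ E) :=
      IsPreconnected.union _ hxL hxE hLconn.isPreconnected hEpc
    have hW'pc : IsPreconnected (ΦT.G '' Γ' ∪ E') :=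
      IsPreconnected.union _ hx'L' hx'E' hL'conn.isPreconnected hE'pc
    have hr₀' : K * ρ + 2 * Φ.δ < r₀ := by linarith [hδ]
    have hS : ∀ a b : Site 2, (zdGraph 2).Adj a b →
        s(a, b) ∈ Φ.revealedIn (Φ.explored ω) ∪ ΦT.revealedIn (ΦT.explored ω) → s(a, b) ∉ ω →
        ∀ q ∈ segment ℝ (meshPoint Φ.δ a) (meshPoint Φ.δ b), q ∈ Q.carrier →
          q ∉ {z | z ∈ Q.carrier ∧ ∀ t ∈ Q.side 3, ∀ p : Path z t,
            range p ⊆ Q.carrier → (range p ∩ (Φ.G '' Γ ∪ E)).Nonempty} →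
          q ∉ {z | z ∈ Q.carrier ∧ ∀ t ∈ Q.side 1, ∀ p : Path z t,
            range p ⊆ Q.carrier → (range p ∩ (ΦT.G '' Γ' ∪ E')).Nonempty} →
          q ∈ range (meshPoint Φ.δ) ∨ dist q (Φ.G (Φ.wallPt ω)) < r₀ ∨
            dist q (ΦT.G (ΦT.wallPt ω)) < r₀ := by
      intro a b hab hSab hclosed q hqseg hqQ hqM hqM'
      have hqa := dist_meshPoint_le_of_mem_segment hδ hab hqseg
      rcases hSab with hS₁ | hS₂
      · rcases hΦ.mem_range_or_exists_mem_of_revealedIn hcar h0 h1 hΓ hEc hEQ hWpc hE2 hAE hEm hE0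
            htame hab hS₁ hclosed hqseg hqQ hqM with hV | ⟨w, hwseg, hwE⟩
        · exact Or.inl hV
        · right; left
          obtain ⟨p, -, hp⟩ := hEjoin w hwE
          have hwx : dist w (Φ.G (Φ.wallPt ω)) ≤ K * ρ := by simpa [p.target] using hp 1
          have hwa := dist_meshPoint_le_of_mem_segment hδ hab hwseg
          have hqw : dist q w ≤ 2 * Φ.δ := by
            linarith [dist_triangle q (meshPoint Φ.δ a) w, dist_comm (meshPoint Φ.δ a) q]
          linarith [dist_triangle q w (Φ.G (Φ.wallPt ω))]
      · have hqQT : q ∈ Q.flip.carrier := by simpa using hqQ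
        have hqM'T : q ∉ {z | z ∈ Q.flip.carrier ∧ ∀ t ∈ Q.flip.side 3, ∀ p : Path z t,
            range p ⊆ Q.flip.carrier → (range p ∩ (ΦT.G '' Γ' ∪ E')).Nonempty} := by
          rw [QuadCrossing.Quad.flip_below_eq]; exact hqM'
        have hqsegT : q ∈ segment ℝ (meshPoint ΦT.δ a) (meshPoint ΦT.δ b) := by rw [hδT]; exact hqseg
        rcases hΦT.mem_range_or_exists_mem_of_revealedIn hcarT h0T h1T hΓ' hE'c hE'QT hW'pc hE'2T
            hAE' hE'm hE'0 htameT hab hS₂ hclosed hqsegT hqQT hqM'T with hV | ⟨w, hwseg, hwE'⟩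
        · left; rw [hδT] at hV; exact hV
        · right; right
          obtain ⟨p, -, hp⟩ := hE'join w hwE'
          have hwx : dist w (ΦT.G (ΦT.wallPt ω)) ≤ K * ρ := by simpa [p.target] using hp 1
          rw [hδT] at hwseg
          have hwa := dist_meshPoint_le_of_mem_segment hδ hab hwseg
          have hqw : dist q w ≤ 2 * Φ.δ := by
            linarith [dist_triangle q (meshPoint Φ.δ a) w, dist_comm (meshPoint Φ.δ a) q]
          linarith [dist_triangle q w (ΦT.G (ΦT.wallPt ω))]
    -- the middle closed arm
    have harm := QuadCrossing.Quad.mem_annulusDualCrossingOff_mid hδ hLc hLconn (hLQ'.trans hcar)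
      hLO (by rw [← h0]; exact hL0') hxL hEc hEpc hEQ hxE hE2 hKρ0 hEjoin hL'c hL'conn hL'Q hL'OΦ
      hL'0 hx'L' hE'c hE'pc hE'Q hx'E' hE'2 hE'join hEM' hnear₃ hnear₁ (by linarith [hδ] : K * ρ < r₀) hslack₁ hslack₂ hR₀
      (S := Φ.revealedIn (Φ.explored ω) ∪ ΦT.revealedIn (ΦT.explored ω)) hS hnot
    show ω ∈ annulusDualCrossingOff (Φ.revealedIn (Φ.explored ω) ∪ ΦT.revealedIn (ΦT.explored ω))
      (Φ.armCentre (Φ.explored ω)) Φ.δ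
      (QuadCrossing.Quad.midInner (dist (ΦT.armCentre (ΦT.explored ω)) (Φ.armCentre (Φ.explored ω)))
        r₀ ρm + 2 * Φ.δ)
      (QuadCrossing.Quad.midOuter (dist (ΦT.armCentre (ΦT.explored ω)) (Φ.armCentre (Φ.explored ω)))
        ρm R₀ - 2 * Φ.δ)
    rw [Φ.armCentre_explored, ΦT.armCentre_explored]
    exact harm
  -- decoupling over the values of the pair `(Λ, Λ_T)`
  have hEsub : Ev ⊆ ⋃ d ∈ 𝒟, A d ∩ F d := fun ω hω =>
    mem_iUnion₂.2 ⟨(Φ.explored ω, ΦT.explored ω),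
      ⟨ω, rfl, rfl, hΦ.crossed hω.1.choose_spec.1 hω.1.choose_spec.2⟩, ⟨rfl, rfl⟩, hkey ω hω⟩
  have hUB : (⋃ d ∈ 𝒟, A d) ⊆ B := by
    intro ω' hω'
    obtain ⟨d, hd, hω'd⟩ := mem_iUnion₂.1 hω'
    obtain ⟨ω, hωd, -, hcr⟩ := hd
    have : Φ.explored ω' = Φ.explored ω := (show Φ.explored ω' = d.1 from hω'd.1).trans hωd.symm
    exact hΦ.exists_isCrossing (Φ.crossed_of_explored_eq hcr this)
  have hAmeas : ∀ d ∈ 𝒟, MeasurableSet (A d) := fun d _ =>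
    (Φ.measurableSet_explored_eq d.1).inter (ΦT.measurableSet_explored_eq d.2)
  have hdisj : 𝒟.PairwiseDisjoint A := fun d _ d' _ hne =>
    disjoint_left.2 fun ω (h : Φ.explored ω = d.1 ∧ ΦT.explored ω = d.2)
      (h' : Φ.explored ω = d'.1 ∧ ΦT.explored ω = d'.2) =>
        hne (Prod.ext (h.1.symm.trans h'.1) (h.2.symm.trans h'.2))
  have hAdet : ∀ d, DeterminedBy (A d) (Sd d) := fun d =>
    ((Φ.determinedBy_explored_eq_revealedIn d.1).mono subset_union_left).inter
      ((ΦT.determinedBy_explored_eq_revealedIn d.2).mono subset_union_right)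
  have hprod : ∀ d ∈ 𝒟, μ (A d ∩ F d) = μ (A d) * μ (F d) := fun d hd =>
    bondPercolation_inter_of_disjoint _ _ disjoint_compl_right (hAdet d)
      (determinedBy_annulusDualCrossingOff _ _ _ _ _) (hAmeas d hd)
      (measurableSet_annulusDualCrossingOff _ hδ _ _ _)
  have hFle : ∀ d ∈ 𝒟, μ (F d) ≤ ENNReal.ofReal η := fun d _ => by
    refine (measure_mono (annulusDualCrossingOff_subset _ _ _ _ _)).trans ?_
    rw [← ENNReal.ofReal_toReal (measure_ne_top μ _)]
    refine ENNReal.ofReal_le_ofReal ?_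
    set s := dist (ΦT.armCentre d.2) (Φ.armCentre d.1) with hs
    by_cases h2 : 2 * ρm ≤ s
    · have h1' : QuadCrossing.Quad.midInner s r₀ ρm = r₀ := by
        simp [QuadCrossing.Quad.midInner, h2]
      have h2' : QuadCrossing.Quad.midOuter s ρm R₀ = ρm := by
        simp [QuadCrossing.Quad.midOuter, h2]
      rw [h1', h2']
      exact (hη _).1
    · have h1' : QuadCrossing.Quad.midInner s r₀ ρm = 3 * ρm := by
        simp [QuadCrossing.Quad.midInner, h2]
      have h2' : QuadCrossing.Quad.midOuter s ρm R₀ = R₀ := by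
        simp [QuadCrossing.Quad.midOuter, h2]
      rw [h1', h2']
      exact (hη _).2
  have hbound := measure_le_mul_of_forall_inter_eq_mul μ h𝒟c hEsub hAmeas hdisj hprod hFle
  have hEv' : μ Ev ≤ ENNReal.ofReal η * μ B := hbound.trans (by gcongr)
  show (μ Ev).toReal ≤ η * (μ B).toReal
  have := ENNReal.toReal_mono (ENNReal.mul_ne_top ENNReal.ofReal_ne_top (measure_ne_top μ B)) hEv'
  rwa [ENNReal.toReal_mul, ENNReal.toReal_ofReal hη0] at this

end Frame

end SSContinuity

end Literature.Probability.Percolation
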